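import Summits.BirchSwinnertonDyer.Rank1Residual.X1.GeneratorBoundMu
import Summits.BirchSwinnertonDyer.Rank1Residual.X5.TwoAdicTargetsTowerGap
import Literature.NumberTheory.EllipticCurves.IwasawaAlgebraProofs
import Literature.NumberTheory.EllipticCurves.IwasawaAlgebraPseudoNullProofs
import Summits.BirchSwinnertonDyer.BirchSwinnertonDyer.Theorems.PrintX9KatoZetaImageLocalized
import Mathlib.LinearAlgebra.TensorProduct.RightExactness
import HarnessLib

/-!
# Route `TwoAdicConverse` (rung S3), crux `OrdLambdaHalfAtTwo` (item 19556): KIT for the HIDDEN-`λ` MODULE —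
# the fibre-product mechanism over `Λ = ℤ_p⟦T⟧` and its three ingredients `Λ/(p)`, `Λ/(T^d + p)`, `Λ/(p, T^d)`

Cell `bsd-2adic` (run/shared/lean/pub/bsd-2adic/), seat `bsd-2adic-conv-1x` (WIDTH-LEVER second lane on item 19556, GEN 5).
THEOREMS ONLY, pure `Λ`-module algebra (nothing about any curve); consumed by `TwoAdicConverseLambdaHalfTowerHiddenLambda.lean`,
whose header explains the point (mod-`p` tower counts certify the `λ`-half but never refute it).

* §1 the fibre product `X = M ×_Q R ⊆ M × R` of `Λ`-linear maps `πM : M → Q`, `πR : R → Q` (given abstractly as a submodule `X` with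
  its membership predicate `hX`): if `p·M = 0`, `πM`, `πR` are onto and `ker πR ⊆ p·R`, then `X/𝔞X ≃ M/𝔞M` for every ideal `𝔞 ∋ p`
  (`nonempty_quotient_equiv`), `λ(X) = rank_{ℤ_p} R` (`lambdaInvariant_eq_of_fibreProduct`, tree `finrank_baseChange_eq_of_pow_smul`),
  and `X` has no nonzero finite submodule when `M` has none and `R` is `p`-torsion-free (`finite_submodule_eq_bot_of_fibreProduct`).
* §2 `T^d + p` is distinguished; `p·(Λ/(p)) = 0`; `T^i − T^j ∉ (p)` (`T ∉ (p)` is the tree's `ZetaImage.X_notMem_augIdealP`); `Λ/(p) = 𝔽_p⟦T⟧` has no nonzero finite submodule;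
  `Λ/(T^d + p)` is `p`-torsion-free (it is `ℤ_p`-free by Weierstrass division, tree `free_quotient_pow`).

HONEST FRAMING. Structural algebra; closes nothing, refutes nothing; item 19556 stays OPEN; nothing booked; BSD is not proved by any
of this. PARTITION (D-0054): none — RANK axis (S3); types-the-object-of (obstruction kit); closes none; bears_on: S3 (19556).

References: L. Washington, GTM 83, §13.1–§13.2 [Washington1997]; S. Lang, Cyclotomic Fields I–II, Ch. 5 §2 Thm. 2.1 [Lang1980];
J. Neukirch, A. Schmidt, K. Wingberg, Cohomology of Number Fields, (5.1.4) Remark 4 [NeukirchSchmidtWingberg2008].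
-/

set_option linter.dupNamespace false
set_option autoImplicit false

noncomputable section

open scoped TensorProduct
open PowerSeries Literature.NumberTheory.EllipticCurves Literature.NumberTheory.EllipticCurves.IwasawaAlgebra
  Summit.BirchSwinnertonDyer.Rank1Residual.X5.TowerGap

namespace Summit.BirchSwinnertonDyer.BirchSwinnertonDyer.Theorems.TwoAdicTwistConverse.HiddenLambda

variable {p : ℕ} [hp : Fact p.Prime]

section FibreProduct

variable {M R Q : Type*} [AddCommGroup M] [Module (IwasawaAlgebra p) M] [AddCommGroup R]
  [Module (IwasawaAlgebra p) R] [AddCommGroup Q] [Module (IwasawaAlgebra p) Q]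
  (πM : M →ₗ[IwasawaAlgebra p] Q) (πR : R →ₗ[IwasawaAlgebra p] Q)
  (X : Submodule (IwasawaAlgebra p) (M × R)) (hX : ∀ x : M × R, x ∈ X ↔ πM x.1 = πR x.2)

include hX

/-- In the fibre product `X = M ×_Q R`, every `a : M` has a companion `(a, b) ∈ X` when `πR` is onto. [folklore] -/
theorem exists_mem_fst_eq (hR : Function.Surjective πR) (a : M) : ∃ x ∈ X, x.1 = a := by
  obtain ⟨b, hb⟩ := hR (πM a)
  exact ⟨(a, b), (hX _).2 hb.symm, rfl⟩

/-- In the fibre product `X = M ×_Q R`, every `b : R` has a companion `(a, b) ∈ X` when `πM` is onto. [folklore] -/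
theorem exists_mem_snd_eq (hM : Function.Surjective πM) (b : R) : ∃ x ∈ X, x.2 = b := by
  obtain ⟨a, ha⟩ := hM (πR b)
  exact ⟨(a, b), (hX _).2 ha, rfl⟩

/-- The first projection `ψ : X → M` of the fibre product is onto when `πR` is onto. [folklore] -/
theorem fst_subtype_surjective (hR : Function.Surjective πR) :
    Function.Surjective ((LinearMap.fst (IwasawaAlgebra p) M R).comp X.subtype) := by
  intro a
  obtain ⟨x, hx, rfl⟩ := exists_mem_fst_eq πM πR X hX hR a
  exact ⟨⟨x, hx⟩, rfl⟩

/-- **Key step.** If `p·M = 0`, `πM` is onto and `ker πR ⊆ p·R`, then the kernel of the first projection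
`ψ : X → M` lies in `p·X`: an element `(0, b) ∈ X` has `πR b = 0`, so `b = p·r`, and `(0, b) = p·(a′, r)` for
any companion `(a′, r) ∈ X` (`p·a′ = 0`). [folklore] -/
theorem mem_smul_top_of_fst_eq_zero (hM : Function.Surjective πM)
    (hpM : ∀ a : M, (C (p : ℤ_[p]) : IwasawaAlgebra p) • a = 0)
    (hkerR : ∀ b : R, πR b = 0 → ∃ r : R, b = (C (p : ℤ_[p]) : IwasawaAlgebra p) • r)
    {𝔞 : Ideal (IwasawaAlgebra p)} (h𝔞 : (C (p : ℤ_[p]) : IwasawaAlgebra p) ∈ 𝔞)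
    (x : X) (hx : (x : M × R).1 = 0) : x ∈ (𝔞 • ⊤ : Submodule (IwasawaAlgebra p) X) := by
  have hx2 : πR (x : M × R).2 = 0 := by rw [← (hX _).1 x.2, hx, map_zero]
  obtain ⟨r, hr⟩ := hkerR _ hx2
  obtain ⟨y, hy, hyr⟩ := exists_mem_snd_eq πM πR X hX hM r
  have hxy : x = (C (p : ℤ_[p]) : IwasawaAlgebra p) • (⟨y, hy⟩ : X) := by
    apply Subtype.ext
    change (x : M × R) = (C (p : ℤ_[p]) : IwasawaAlgebra p) • y
    ext
    · rw [Prod.smul_fst, hpM, hx]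
    · rw [Prod.smul_snd, hyr, ← hr]
  rw [hxy]
  exact Submodule.smul_mem_smul h𝔞 Submodule.mem_top

/-- **The fibre product has the mod-`𝔞` quotients of `M`** for every ideal `𝔞 ∋ p` (hypotheses as in
`mem_smul_top_of_fst_eq_zero`, plus `πR` onto): `X/𝔞X ≃ M/𝔞M`, induced by the first projection. [folklore] -/
theorem nonempty_quotient_equiv (hM : Function.Surjective πM) (hR : Function.Surjective πR)
    (hpM : ∀ a : M, (C (p : ℤ_[p]) : IwasawaAlgebra p) • a = 0)
    (hkerR : ∀ b : R, πR b = 0 → ∃ r : R, b = (C (p : ℤ_[p]) : IwasawaAlgebra p) • r)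
    (𝔞 : Ideal (IwasawaAlgebra p)) (h𝔞 : (C (p : ℤ_[p]) : IwasawaAlgebra p) ∈ 𝔞) :
    Nonempty ((X ⧸ (𝔞 • ⊤ : Submodule (IwasawaAlgebra p) X)) ≃ₗ[IwasawaAlgebra p]
      (M ⧸ (𝔞 • ⊤ : Submodule (IwasawaAlgebra p) M))) := by
  set ψ : X →ₗ[IwasawaAlgebra p] M := (LinearMap.fst (IwasawaAlgebra p) M R).comp X.subtype with hψ
  have hψs : Function.Surjective ψ := fst_subtype_surjective πM πR X hX hR
  set θ : X →ₗ[IwasawaAlgebra p] M ⧸ (𝔞 • ⊤ : Submodule (IwasawaAlgebra p) M) :=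
    (𝔞 • ⊤ : Submodule (IwasawaAlgebra p) M).mkQ.comp ψ with hθ
  have hθs : Function.Surjective θ := (Submodule.mkQ_surjective _).comp hψs
  have hker : LinearMap.ker θ = (𝔞 • ⊤ : Submodule (IwasawaAlgebra p) X) := by
    apply le_antisymm
    · intro x hxk
      rw [LinearMap.mem_ker, hθ, LinearMap.comp_apply, Submodule.mkQ_apply,
        Submodule.Quotient.mk_eq_zero] at hxk
      -- `𝔞 • ⊤_M = map ψ (𝔞 • ⊤_X)` since `ψ` is onto
      have hmap : (𝔞 • ⊤ : Submodule (IwasawaAlgebra p) M) =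
          Submodule.map ψ (𝔞 • ⊤ : Submodule (IwasawaAlgebra p) X) := by
        rw [Submodule.map_smul'', Submodule.map_top, LinearMap.range_eq_top.2 hψs]
      rw [hmap] at hxk
      obtain ⟨y, hy, hyx⟩ := hxk
      have hdiff : x - y ∈ (𝔞 • ⊤ : Submodule (IwasawaAlgebra p) X) := by
        refine mem_smul_top_of_fst_eq_zero πM πR X hX hM hpM hkerR h𝔞 (x - y) ?_
        have : ψ (x - y) = 0 := by rw [map_sub, hyx, sub_self]
        simpa [hψ] using this
      have : x = (x - y) + y := by abel
      rw [this]
      exact Submodule.add_mem _ hdiff hy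
    · rw [Submodule.smul_le]
      intro r hr x _
      rw [LinearMap.mem_ker, map_smul, hθ, LinearMap.comp_apply, Submodule.mkQ_apply,
        ← Submodule.Quotient.mk_smul, Submodule.Quotient.mk_eq_zero]
      exact Submodule.smul_mem_smul hr Submodule.mem_top
  exact ⟨(Submodule.quotEquivOfEq _ _ hker.symm).trans (LinearMap.quotKerEquivOfSurjective θ hθs)⟩

/-- **`λ` of the fibre product is the `ℤ_p`-rank of `R`** when `πM` is onto and `p·M = 0`: the second
projection `X → R` is onto with kernel killed by `p`, and `ℚ_p ⊗ (−)` does not see `p`-power torsion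
(`finrank_baseChange_eq_of_pow_smul`; `R` with any `ℤ_p`-structure compatible with `Λ`). [folklore] -/
theorem lambdaInvariant_eq_of_fibreProduct [Module ℤ_[p] R] [IsScalarTower ℤ_[p] (IwasawaAlgebra p) R]
    (hM : Function.Surjective πM) (hpM : ∀ a : M, (C (p : ℤ_[p]) : IwasawaAlgebra p) • a = 0) :
    lambdaInvariant p X = Module.finrank ℚ_[p] (ℚ_[p] ⊗[ℤ_[p]] R) := by
  letI : Module ℤ_[p] X := Module.compHom X (algebraMap ℤ_[p] (IwasawaAlgebra p))
  haveI : IsScalarTower ℤ_[p] (IwasawaAlgebra p) X := IsScalarTower.of_compHom _ _ _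
  set θ : X →ₗ[IwasawaAlgebra p] R := (LinearMap.snd (IwasawaAlgebra p) M R).comp X.subtype with hθ
  have hker : ∀ x : X, θ.restrictScalars ℤ_[p] x = 0 → ∃ n : ℕ, (p : ℤ_[p]) ^ n • x = 0 := by
    intro x hx
    refine ⟨1, ?_⟩
    rw [algebraMap_p_pow_smul p 1 x, pow_one]
    apply Subtype.ext
    change (C (p : ℤ_[p]) : IwasawaAlgebra p) • (x : M × R) = 0
    have hx2 : (x : M × R).2 = 0 := hx
    ext
    · rw [Prod.smul_fst, hpM, Prod.fst_zero]
    · rw [Prod.smul_snd, hx2, smul_zero, Prod.snd_zero]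
  have hcoker : ∀ b : R, ∃ (n : ℕ) (x : X), (p : ℤ_[p]) ^ n • b = θ.restrictScalars ℤ_[p] x := by
    intro b
    obtain ⟨y, hy, hyb⟩ := exists_mem_snd_eq πM πR X hX hM b
    exact ⟨0, ⟨y, hy⟩, by rw [pow_zero, one_smul]; exact hyb.symm⟩
  have key := Module.finrank_baseChange_eq_of_pow_smul ℚ_[p] (isUnit_algebraMap_p p)
    (θ.restrictScalars ℤ_[p]) hker hcoker
  unfold lambdaInvariant
  change Module.finrank ℚ_[p] (ℚ_[p] ⊗[ℤ_[p]] X) = Module.finrank ℚ_[p] (ℚ_[p] ⊗[ℤ_[p]] R)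
  exact key

omit hX in
/-- **The fibre product has no nonzero finite `Λ`-submodule** if `M` has none and `R` has no nonzero
element killed by a power of `p`: a finite submodule `N ≤ X` is pseudo-null, so each `y ∈ N` is killed by
some `pⁿ`, forcing `y.2 = 0`; then the first projection of `N` is a finite submodule of `M`, hence `0`.
[cite: Washington1997, §13.2 (pseudo-null = finite)] -/
theorem finite_submodule_eq_bot_of_fibreProduct
    (hMnf : ∀ N : Submodule (IwasawaAlgebra p) M, Finite N → N = ⊥)
    (hRtf : ∀ (b : R) (n : ℕ), (C (p : ℤ_[p]) : IwasawaAlgebra p) ^ n • b = 0 → b = 0)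
    (N : Submodule (IwasawaAlgebra p) X) (hN : Finite N) : N = ⊥ := by
  haveI : Finite N := hN
  set ψ : X →ₗ[IwasawaAlgebra p] M := (LinearMap.fst (IwasawaAlgebra p) M R).comp X.subtype with hψ
  -- the first projection of `N` is a finite submodule of `M`, hence trivial
  have hψN : Submodule.map ψ N = ⊥ := by
    refine hMnf _ ?_
    exact Finite.of_surjective (fun y : N => (⟨ψ y, Submodule.mem_map_of_mem y.2⟩ : Submodule.map ψ N))
      (by rintro ⟨_, y, hy, rfl⟩; exact ⟨⟨y, hy⟩, rfl⟩)
  rw [eq_bot_iff]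
  intro y hy
  have hPN : Module.IsPseudoNull (IwasawaAlgebra p) N := isPseudoNull_of_finite p N
  obtain ⟨n, hn⟩ := exists_C_p_pow_smul_eq_zero_of_isPseudoNull p hPN ⟨y, hy⟩
  have hn' : (C (p : ℤ_[p]) : IwasawaAlgebra p) ^ n • (y : M × R) = 0 := by
    have := congrArg (fun z : N => ((z : X) : M × R)) hn
    simpa using this
  have h2 : (y : M × R).2 = 0 := hRtf _ n (by rw [← Prod.smul_snd, hn', Prod.snd_zero])
  have h1 : (y : M × R).1 = 0 := by
    have : ψ y ∈ Submodule.map ψ N := Submodule.mem_map_of_mem hy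
    rw [hψN, Submodule.mem_bot] at this
    exact this
  rw [Submodule.mem_bot]
  exact Subtype.ext (Prod.ext h1 h2)

end FibreProduct

/-! ## §2 The ingredients over `Λ = ℤ_p⟦T⟧`: `M = Λ/(p)`, `R = Λ/(T^d + p)`, `Q = Λ/(p, T^d)` -/

section Ingredients

variable (p)

/-- `T^d + p ∈ ℤ_p[T]` is a distinguished polynomial for `d ≠ 0`. [folklore] -/
theorem isDistinguishedAt_X_pow_add_C (d : ℕ) (hd : d ≠ 0) :
    (Polynomial.X ^ d + Polynomial.C (p : ℤ_[p]) : Polynomial ℤ_[p]).IsDistinguishedAt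
      (IsLocalRing.maximalIdeal ℤ_[p]) where
  mem := by
    intro n hn
    rw [Polynomial.natDegree_X_pow_add_C] at hn
    rw [Polynomial.coeff_add, Polynomial.coeff_X_pow, Polynomial.coeff_C, if_neg hn.ne,
      zero_add, PadicInt.maximalIdeal_eq_span_p]
    split_ifs
    · exact Ideal.mem_span_singleton_self _
    · exact Submodule.zero_mem _
  monic := Polynomial.monic_X_pow_add_C _ hd

/-- The power series of `T^d + p` is `T^d + p`. [folklore] -/
theorem coe_X_pow_add_C (d : ℕ) :
    ((Polynomial.X ^ d + Polynomial.C (p : ℤ_[p]) : Polynomial ℤ_[p]) : IwasawaAlgebra p) =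
      (PowerSeries.X : IwasawaAlgebra p) ^ d + C (p : ℤ_[p]) := by
  rw [Polynomial.coe_add, Polynomial.coe_pow, Polynomial.coe_X, Polynomial.coe_C]

/-- `p` kills `M = Λ/(p)`. [folklore] -/
theorem C_p_smul_quotient_augIdealP (a : IwasawaAlgebra p ⧸ augIdealP p) :
    (C (p : ℤ_[p]) : IwasawaAlgebra p) • a = 0 := by
  obtain ⟨a₀, rfl⟩ := Submodule.Quotient.mk_surjective _ a
  rw [← Submodule.Quotient.mk_smul, Submodule.Quotient.mk_eq_zero, smul_eq_mul]
  exact Ideal.mul_mem_right _ _ (Ideal.mem_span_singleton_self _)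

/-- `T^i - T^j ∉ (p)` for `i < j`: `T^i ∉ (p)` (prime) and `1 - T^{j-i}` is a unit. [folklore] -/
theorem X_pow_sub_X_pow_notMem_augIdealP {i j : ℕ} (hij : i < j) :
    (PowerSeries.X : IwasawaAlgebra p) ^ i - PowerSeries.X ^ j ∉ augIdealP p := by
  have hprime : (augIdealP p).IsPrime := isPrime_augIdealP_holds p
  have hfac : (PowerSeries.X : IwasawaAlgebra p) ^ i - PowerSeries.X ^ j =
      PowerSeries.X ^ i * (1 - PowerSeries.X ^ (j - i)) := by
    rw [mul_sub, mul_one, ← pow_add, Nat.add_sub_cancel' hij.le]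
  rw [hfac]
  intro h
  rcases hprime.mem_or_mem h with h1 | h2
  · exact Summit.BirchSwinnertonDyer.BirchSwinnertonDyer.Rank1Residual.ZetaImage.X_notMem_augIdealP (p := p)
      (hprime.mem_of_pow_mem i h1)
  · have hu : IsUnit (1 - (PowerSeries.X : IwasawaAlgebra p) ^ (j - i)) := by
      rw [PowerSeries.isUnit_iff_constantCoeff, map_sub, map_one, map_pow,
        PowerSeries.constantCoeff_X, zero_pow (Nat.sub_ne_zero_of_lt hij), sub_zero]
      exact isUnit_one
    exact hprime.ne_top (Ideal.eq_top_of_isUnit_mem _ h2 hu)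

/-- **`M = Λ/(p) = 𝔽_p⟦T⟧` has no nonzero finite `Λ`-submodule**: for `y ≠ 0` the `T^n · y` are pairwise
distinct (`Λ/(p)` is a domain and `T^i - T^j ∉ (p)`). [cite: Washington1997, §13.1] -/
theorem finite_submodule_quotient_augIdealP_eq_bot
    (N : Submodule (IwasawaAlgebra p) (IwasawaAlgebra p ⧸ augIdealP p)) (hN : Finite N) : N = ⊥ := by
  haveI : Finite N := hN
  have hprime : (augIdealP p).IsPrime := isPrime_augIdealP_holds p
  rw [eq_bot_iff]
  intro y hy
  obtain ⟨i, j, hij, heq⟩ := Finite.exists_ne_map_eq_of_infinite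
    (fun n : ℕ => (⟨(PowerSeries.X : IwasawaAlgebra p) ^ n • y, N.smul_mem _ hy⟩ : N))
  have heq' : (PowerSeries.X : IwasawaAlgebra p) ^ i • y = (PowerSeries.X : IwasawaAlgebra p) ^ j • y :=
    congrArg Subtype.val heq
  -- reduce to `i < j`
  have key : ∀ {i j : ℕ}, i < j →
      (PowerSeries.X : IwasawaAlgebra p) ^ i • y = (PowerSeries.X : IwasawaAlgebra p) ^ j • y → y = 0 := by
    intro i j hlt h
    obtain ⟨y₀, rfl⟩ := Submodule.Quotient.mk_surjective _ y
    have h0 : ((PowerSeries.X : IwasawaAlgebra p) ^ i - PowerSeries.X ^ j) • Submodule.Quotient.mk y₀ =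
        (0 : IwasawaAlgebra p ⧸ augIdealP p) := by rw [sub_smul, h, sub_self]
    rw [← Submodule.Quotient.mk_smul, Submodule.Quotient.mk_eq_zero, smul_eq_mul] at h0
    rw [Submodule.Quotient.mk_eq_zero]
    exact (hprime.mem_or_mem h0).resolve_left (X_pow_sub_X_pow_notMem_augIdealP p hlt)
  rw [Submodule.mem_bot]
  rcases Nat.lt_or_gt_of_ne hij with hlt | hgt
  · exact key hlt heq'
  · exact key hgt heq'.symm

/-- `R = Λ/(T^d + p)` has no nonzero element killed by a power of `p` (it is `ℤ_p`-free). [folklore] -/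
theorem eq_zero_of_C_p_pow_smul_eq_zero_quotient (d : ℕ) (hd : d ≠ 0)
    (b : IwasawaAlgebra p ⧸ Ideal.span
      {((Polynomial.X ^ d + Polynomial.C (p : ℤ_[p]) : Polynomial ℤ_[p]) : IwasawaAlgebra p) ^ 1})
    (n : ℕ) (h : (C (p : ℤ_[p]) : IwasawaAlgebra p) ^ n • b = 0) : b = 0 := by
  haveI := free_quotient_pow p (isDistinguishedAt_X_pow_add_C p d hd) 1
  rw [← algebraMap_p_pow_smul p n b] at h
  exact (smul_eq_zero.1 h).resolve_left (pow_ne_zero _ (by exact_mod_cast (Fact.out : p.Prime).ne_zero))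

end Ingredients


end Summit.BirchSwinnertonDyer.BirchSwinnertonDyer.Theorems.TwoAdicTwistConverse.HiddenLambda

end
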